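import Literature.Geometry.Riemannian.RicciFlowScalarMaximumPrinciple
import Literature.Geometry.Riemannian.ShiDerivativeMaxPrinciple
import Literature.Geometry.Riemannian.CurvatureDerivativeNormSq
import Literature.Geometry.Riemannian.RicciFlowShiEstimates
import HarnessLib

/-!
# The Bernstein–Shi window lemma (abstract maximum-principle step)
(helper `helper_bernsteinWindow`, layer S3w of stub `stub_smoothRoundLimit` of line
`margerin-cone-hamilton-rails`, crux `EntropyRung.ChangGurskyYang`, item stmt-SmoothPoincare4-10834)

The analytic core of the Bernstein–Bando–Shi derivative estimates (Hamilton 1982, §13; Shi 1989,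
§7; Topping 2006, Thm. 3.3.1) isolated from all curvature bookkeeping: a pure weak-maximum-principle
statement about two nonnegative functions `f, F`, jointly `C^∞` on `M × [0, T)` over a closed
manifold carrying Riemannian metrics `g t`, which satisfy

  `∂ₜ f ≤ Δ_{g(t)} f − θ F + Φ_f`,   `∂ₜ F ≤ Δ_{g(t)} F + Φ_F`   (`θ > 0`)

(`∂ₜ` the one-sided time derivative within `[0, T)`, `Δ = laplaceBeltrami`). On a window
`[t₁, t₁ + τ] ⊂ [0, T)` on which `Φ_f ≤ a`, `Φ_F ≤ K F + b` and `K τ ≤ 1`, `f(t₁, ·) ≤ A₀`, one gets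

  `(t − t₁) F(t, x) ≤ (2/θ) A₀ + τ (τ b + 2a/θ)`   for `t ∈ [t₁, t₁ + τ]`.

In the application (`helper_curvDeriv_decay_one/all`) `f = |∇ᵏRm|²` (or the round defect) and
`F = |∇ᵏ⁺¹Rm|²`.

## Proof

* `bernsteinWindow_core` (the un-shifted statement on `[0, τ]`): with
  `u(s, x) = s F(s, x) + (2/θ) f(s, x)` one has, by the product rule (`hasDerivWithinAt_time`) and
  the linearity of the Laplace–Beltrami operator on `C²` functions (`laplaceBeltrami_add_mul`),
  `∂ₛu ≤ Δu + F(sK − 1) + s b + 2a/θ ≤ Δu + (τ b + 2a/θ)`; the weak maximum principle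
  (`weakMaximumPrinciple`, Topping 2006, Thm. 3.1.1, `X ≡ 0`, `F ≡ τ b + 2a/θ`,
  `φ(s) = (2/θ)A₀ + (τ b + 2a/θ) s`) gives `u ≤ φ ≤ (2/θ)A₀ + τ(τ b + 2a/θ)`, and `s F ≤ u` as
  `f ≥ 0`. This is the template `shi_maxPrinciple_step` with two levels.
* `helper_bernsteinWindow` (restart): apply the core to `s ↦ g(s + t₁)`, `f(s + t₁, ·)`,
  `F(s + t₁, ·)` on `[0, τ]`; joint smoothness transfers by composition with `(x, s) ↦ (x, s + t₁)`
  and the time derivatives within `[0, τ]` of the translates are the time derivatives within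
  `[0, T)` (`hasDerivWithinAt_time_of`, chain rule, `uniqueDiffOn_Icc`), as in
  `shi_maxPrinciple_bound_Icc`.

## References

* R. S. Hamilton, *Three-manifolds with positive Ricci curvature*, J. Differential Geom. 17
  (1982) 255–306, §13. [Hamilton1982]
* W.-X. Shi, *Deforming the metric on complete Riemannian manifolds*, J. Differential Geom. 30
  (1989) 223–301, §7.
* P. Topping, *Lectures on the Ricci flow*, LMS Lecture Note Series 325, CUP 2006, Thm. 3.1.1,
  Thm. 3.3.1. [Topping2006]
-/

noncomputable section

-- every `Summit.SmoothPoincare4.SmoothPoincare4.…` name repeats the summit = sub-problem segment (D-0017 layout)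
set_option linter.dupNamespace false

open Set Function Filter
open scoped Manifold ContDiff Topology

namespace Summit.SmoothPoincare4.SmoothPoincare4.Theorems.MargerinRails

open Literature.Geometry.Riemannian
open Literature.Geometry.Lorentzian Literature.Geometry.Lorentzian.PseudoRiemannianMetric

section Core

variable {E : Type*} [NormedAddCommGroup E] [NormedSpace ℝ E] [FiniteDimensional ℝ E]
  [CompleteSpace E] {H : Type*} [TopologicalSpace H] {I : ModelWithCorners ℝ E H}
  [I.Boundaryless] {M : Type*} [TopologicalSpace M] [ChartedSpace H M] [IsManifold I ∞ M]

/-- **The Bernstein–Shi window lemma on `[0, τ]`** (abstract maximum-principle step of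
Hamilton 1982, §13 / Topping 2006, Thm. 3.3.1): closed manifold, Riemannian metrics `g t`,
`f, F ≥ 0` jointly `C^∞` on `M × [0, τ]` with `∂ₜ f ≤ Δ f − θ F + a`, `∂ₜ F ≤ Δ F + K F + b`
(`∂ₜ = derivWithin` within `[0, τ]`), `θ > 0`, `K, a, b ≥ 0`, `K τ ≤ 1`, `f(0, ·) ≤ A₀`. THEN
`t F(t, x) ≤ (2/θ) A₀ + τ (τ b + 2a/θ)` on `M × [0, τ]`: the weak maximum principle
(`weakMaximumPrinciple`, Thm. 3.1.1) for `u = t F + (2/θ) f`, which satisfies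
`∂ₜ u ≤ Δ u + (τ b + 2a/θ)`, `u(0, ·) ≤ (2/θ) A₀`.
[cite: Hamilton1982, §13] [cite: Topping2006, Thm. 3.1.1] -/
theorem bernsteinWindow_core [CompactSpace M]
    {g : ℝ → PseudoRiemannianMetric I ∞ E (TangentSpace I : M → Type _)} {τ θ K a b A₀ : ℝ}
    {f F : ℝ → M → ℝ} (hτ : 0 < τ) (hθ : 0 < θ)
    (hgR : ∀ t ∈ Icc 0 τ, (g t).IsRiemannian)
    (hf : ContMDiffOn (I.prod 𝓘(ℝ, ℝ)) 𝓘(ℝ, ℝ) ∞ (fun p : M × ℝ ↦ f p.2 p.1) (univ ×ˢ Icc 0 τ))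
    (hF : ContMDiffOn (I.prod 𝓘(ℝ, ℝ)) 𝓘(ℝ, ℝ) ∞ (fun p : M × ℝ ↦ F p.2 p.1) (univ ×ˢ Icc 0 τ))
    (hfnn : ∀ t ∈ Icc 0 τ, ∀ x, 0 ≤ f t x) (hFnn : ∀ t ∈ Icc 0 τ, ∀ x, 0 ≤ F t x)
    (hK : 0 ≤ K) (ha : 0 ≤ a) (hb : 0 ≤ b) (hKτ : K * τ ≤ 1) (h0 : ∀ x, f 0 x ≤ A₀)
    (hevf : ∀ t ∈ Icc 0 τ, ∀ x, derivWithin (fun s ↦ f s x) (Icc 0 τ) t ≤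
      (g t).laplaceBeltrami (f t) x - θ * F t x + a)
    (hevF : ∀ t ∈ Icc 0 τ, ∀ x, derivWithin (fun s ↦ F s x) (Icc 0 τ) t ≤
      (g t).laplaceBeltrami (F t) x + K * F t x + b) :
    ∀ t ∈ Icc 0 τ, ∀ x, t * F t x ≤ 2 / θ * A₀ + τ * (τ * b + 2 * a / θ) := by
  have h2le : (2 : ℕ∞ω) ≤ ∞ := WithTop.coe_le_coe.mpr le_top
  have hθ0 : θ ≠ 0 := hθ.ne'
  have hθ' : 0 ≤ 2 / θ := by positivity
  have hDnn : 0 ≤ τ * b + 2 * a / θ := by positivity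
  -- the auxiliary function `u = t F + (2/θ) f`
  set u : ℝ → M → ℝ := fun s x ↦ s * F s x + 2 / θ * f s x with hu
  have husmooth : ContMDiffOn (I.prod 𝓘(ℝ, ℝ)) 𝓘(ℝ, ℝ) ∞ (fun p : M × ℝ ↦ u p.2 p.1)
      (univ ×ˢ Icc 0 τ) := by
    have h1 : ContMDiffOn (I.prod 𝓘(ℝ, ℝ)) 𝓘(ℝ, ℝ) ∞ (fun p : M × ℝ ↦ p.2 * F p.2 p.1)
        (univ ×ˢ Icc 0 τ) := contMDiff_snd.contMDiffOn.mul hF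
    have h2 : ContMDiffOn (I.prod 𝓘(ℝ, ℝ)) 𝓘(ℝ, ℝ) ∞ (fun p : M × ℝ ↦ 2 / θ * f p.2 p.1)
        (univ ×ˢ Icc 0 τ) := contMDiffOn_const.mul hf
    exact h1.add h2
  -- the differential inequality `∂_t u ≤ Δ u + (τ b + 2a/θ)`
  have hineq : ∀ t ∈ Icc 0 τ, ∀ x : M, derivWithin (fun s ↦ u s x) (Icc 0 τ) t ≤
      (g t).laplaceBeltrami (u t) x + mvfderiv I (u t) x ((fun (_ : ℝ) (_ : M) ↦ (0 : E)) t x)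
        + (fun (_ _ : ℝ) ↦ τ * b + 2 * a / θ) (u t x) t := by
    intro t ht x
    have hmv : mvfderiv I (u t) x ((fun (_ : ℝ) (_ : M) ↦ (0 : E)) t x) = 0 := map_zero _
    rw [hmv, add_zero]
    show derivWithin (fun s ↦ u s x) (Icc 0 τ) t ≤
      (g t).laplaceBeltrami (u t) x + (τ * b + 2 * a / θ)
    -- (1) the time derivative of `u`
    have hsf := hasDerivWithinAt_time (n := ∞) (by simp) hf x ht
    have hsF := hasDerivWithinAt_time (n := ∞) (by simp) hF x ht
    set d₁ := derivWithin (fun s ↦ f s x) (Icc 0 τ) t with hd₁def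
    set d₂ := derivWithin (fun s ↦ F s x) (Icc 0 τ) t with hd₂def
    have hdu : HasDerivWithinAt (fun s ↦ u s x) (1 * F t x + t * d₂ + 2 / θ * d₁) (Icc 0 τ) t :=
      ((hasDerivWithinAt_id t _).mul hsF).add (hsf.const_mul (2 / θ))
    rw [hdu.derivWithin (uniqueDiffOn_Icc hτ t ht), one_mul]
    -- (2) the Laplacian of `u(·, t)`
    have hsm₁ : CMDiffAt 2 (F t) x := ((contMDiff_slice hF ht).of_le h2le).contMDiffAt
    have hsm₂ : CMDiffAt 2 (f t) x := ((contMDiff_slice hf ht).of_le h2le).contMDiffAt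
    have hlap : (g t).laplaceBeltrami (u t) x =
        t * (g t).laplaceBeltrami (F t) x + 2 / θ * (g t).laplaceBeltrami (f t) x :=
      laplaceBeltrami_add_mul (g t) hsm₁ hsm₂ t (2 / θ)
    rw [hlap]
    -- (3) the pointwise algebra
    have hq₁ := hevf t ht x
    have hq₂ := hevF t ht x
    rw [← hd₁def] at hq₁
    rw [← hd₂def] at hq₂
    have hFx : 0 ≤ F t x := hFnn t ht x
    have ht0 : 0 ≤ t := ht.1
    have htK : t * K ≤ 1 :=
      calc t * K ≤ τ * K := mul_le_mul_of_nonneg_right ht.2 hK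
        _ = K * τ := mul_comm _ _
        _ ≤ 1 := hKτ
    have hKF : t * K * F t x ≤ F t x := by
      have h := mul_le_mul_of_nonneg_right htK hFx
      rwa [one_mul] at h
    have htb : t * b ≤ τ * b := mul_le_mul_of_nonneg_right ht.2 hb
    have hθF : 2 / θ * (θ * F t x) = 2 * F t x := by
      field_simp
    have hθa : 2 / θ * a = 2 * a / θ := by ring
    generalize (g t).laplaceBeltrami (F t) x = L₁ at hq₂ ⊢
    generalize (g t).laplaceBeltrami (f t) x = L₂ at hq₁ ⊢
    have step1 : t * d₂ ≤ t * (L₁ + K * F t x + b) := mul_le_mul_of_nonneg_left hq₂ ht0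
    have step2 : 2 / θ * d₁ ≤ 2 / θ * (L₂ - θ * F t x + a) := mul_le_mul_of_nonneg_left hq₁ hθ'
    linarith [step1, step2, hθF, hKF, htb, hθa, hFx]
  -- (4) the weak maximum principle
  have hFc : ContDiffOn ℝ 1 (uncurry fun (_ _ : ℝ) ↦ τ * b + 2 * a / θ) (univ ×ˢ Icc 0 τ) :=
    contDiffOn_const
  set φ : ℝ → ℝ := fun s ↦ 2 / θ * A₀ + (τ * b + 2 * a / θ) * s with hφ
  have hφd : ∀ s ∈ Icc 0 τ,
      HasDerivWithinAt φ ((fun (_ _ : ℝ) ↦ τ * b + 2 * a / θ) (φ s) s) (Icc 0 τ) s := by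
    intro s _
    show HasDerivWithinAt φ (τ * b + 2 * a / θ) (Icc 0 τ) s
    have h : HasDerivAt φ (τ * b + 2 * a / θ) s := by
      have h1 := ((hasDerivAt_id s).const_mul (τ * b + 2 * a / θ)).const_add (2 / θ * A₀)
      simpa [hφ] using h1
    exact h.hasDerivWithinAt
  have hφ0 : φ 0 = 2 / θ * A₀ := by simp [hφ]
  have hu0 : ∀ x : M, u 0 x ≤ 2 / θ * A₀ := by
    intro x
    show 0 * F 0 x + 2 / θ * f 0 x ≤ 2 / θ * A₀
    rw [zero_mul, zero_add]
    exact mul_le_mul_of_nonneg_left (h0 x) hθ'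
  have hmp := weakMaximumPrinciple hτ hgR (fun (_ : ℝ) (_ : M) ↦ (0 : E)) hFc husmooth hineq
    hφd hφ0 hu0
  -- (5) extraction
  intro t ht x
  have hut : t * F t x ≤ u t x := le_add_of_nonneg_right (mul_nonneg hθ' (hfnn t ht x))
  have hφt : φ t ≤ 2 / θ * A₀ + τ * (τ * b + 2 * a / θ) := by
    show 2 / θ * A₀ + (τ * b + 2 * a / θ) * t ≤ 2 / θ * A₀ + τ * (τ * b + 2 * a / θ)
    have h : (τ * b + 2 * a / θ) * t ≤ (τ * b + 2 * a / θ) * τ :=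
      mul_le_mul_of_nonneg_left ht.2 hDnn
    linarith [h]
  exact hut.trans ((hmp t ht x).trans hφt)

end Core

/-- **The Bernstein–Shi window lemma** (layer S3w of `stub_smoothRoundLimit`; the abstract
maximum-principle step of Hamilton 1982, §13 / Shi 1989, §7 / Topping 2006, Thm. 3.3.1): on a
closed 4-manifold with Riemannian metrics `g t`, `t ∈ [0, T)`, let `f, F ≥ 0` be jointly `C^∞` on
`M × [0, T)` with `∂ₜ f ≤ Δ f − θ F + Φ_f`, `∂ₜ F ≤ Δ F + Φ_F` (`∂ₜ` within `[0, T)`, `θ > 0`).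
On a window `[t₁, t₁ + τ] ⊂ [0, T)` with `Φ_f ≤ a`, `Φ_F ≤ K F + b`, `K τ ≤ 1`, `f(t₁, ·) ≤ A₀`
(`K, a, b ≥ 0`): `(t − t₁) F(t, x) ≤ (2/θ) A₀ + τ (τ b + 2a/θ)` for `t ∈ [t₁, t₁ + τ]`. Proof:
`bernsteinWindow_core` for the restarted data `s ↦ g(s + t₁), f(s + t₁, ·), F(s + t₁, ·)` on
`[0, τ]` (time derivatives within `[0, τ]` of the translates agree with those within `[0, T)`,
`hasDerivWithinAt_time_of`). [cite: Hamilton1982, §13] [cite: Topping2006, Thm. 3.1.1] -/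
theorem helper_bernsteinWindow : ∀ (M : Type) [TopologicalSpace M] [T2Space M] [SecondCountableTopology M] [ChartedSpace (EuclideanSpace ℝ (Fin 4)) M] [IsManifold (𝓡 4) ∞ M] [CompactSpace M] (g : ℝ → PseudoRiemannianMetric (𝓡 4) ∞ (EuclideanSpace ℝ (Fin 4)) (TangentSpace (𝓡 4) : M → Type _)) (T θ : ℝ) (f F Φf ΦF : ℝ → M → ℝ), 0 < T → 0 < θ → (∀ t ∈ Ico 0 T, (g t).IsRiemannian) → ContMDiffOn ((𝓡 4).prod 𝓘(ℝ, ℝ)) 𝓘(ℝ, ℝ) ∞ (fun p : M × ℝ ↦ f p.2 p.1) (univ ×ˢ Ico 0 T) → ContMDiffOn ((𝓡 4).prod 𝓘(ℝ, ℝ)) 𝓘(ℝ, ℝ) ∞ (fun p : M × ℝ ↦ F p.2 p.1) (univ ×ˢ Ico 0 T) → (∀ t ∈ Ico 0 T, ∀ x : M, 0 ≤ f t x) → (∀ t ∈ Ico 0 T, ∀ x : M, 0 ≤ F t x) → (∀ t ∈ Ico 0 T, ∀ x : M, derivWithin (fun s ↦ f s x) (Ico 0 T) t ≤ (g t).laplaceBeltrami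 (f t) x - θ * F t x + Φf t x) → (∀ t ∈ Ico 0 T, ∀ x : M, derivWithin (fun s ↦ F s x) (Ico 0 T) t ≤ (g t).laplaceBeltrami (F t) x + ΦF t x) → ∀ (t₁ τ K a b A₀ : ℝ), t₁ ∈ Ico 0 T → 0 < τ → t₁ + τ < T → 0 ≤ K → 0 ≤ a → 0 ≤ b → K * τ ≤ 1 → (∀ x : M, f t₁ x ≤ A₀) → (∀ t ∈ Icc t₁ (t₁ + τ), ∀ x : M, Φf t x ≤ a) → (∀ t ∈ Icc t₁ (t₁ + τ), ∀ x : M, ΦF t x ≤ K * F t x + b) → ∀ t ∈ Icc t₁ (t₁ + τ), ∀ x : M, (t - t₁) * F t x ≤ 2 / θ * A₀ + τ * (τ * b + 2 * a / θ) := by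
  intro M _ _ _ _ _ _ g T θ f F Φf ΦF hT hθ hgR hf hF hfnn hFnn hevf hevF t₁ τ K a b A₀ ht₁ hτ
    ht₁τ hK ha hb hKτ hA₀ hΦf hΦF
  -- the window `[t₁, t₁ + τ]` translated to `[0, τ]`
  have hmem : ∀ s ∈ Icc 0 τ, s + t₁ ∈ Ico 0 T := fun s hs ↦
    ⟨by linarith [hs.1, ht₁.1], by linarith [hs.2]⟩
  have hmem' : ∀ s ∈ Icc 0 τ, s + t₁ ∈ Icc t₁ (t₁ + τ) := fun s hs ↦
    ⟨by linarith [hs.1], by linarith [hs.2]⟩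
  have hmaps : MapsTo (fun s : ℝ ↦ s + t₁) (Icc 0 τ) (Ico 0 T) := fun s hs ↦ hmem s hs
  -- joint smoothness of the translates
  have htr : ∀ {u : ℝ → M → ℝ},
      ContMDiffOn ((𝓡 4).prod 𝓘(ℝ, ℝ)) 𝓘(ℝ, ℝ) ∞ (fun p : M × ℝ ↦ u p.2 p.1) (univ ×ˢ Ico 0 T) →
      ContMDiffOn ((𝓡 4).prod 𝓘(ℝ, ℝ)) 𝓘(ℝ, ℝ) ∞ (fun p : M × ℝ ↦ u (p.2 + t₁) p.1)
        (univ ×ˢ Icc 0 τ) := by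
    intro u hu
    have hφ : ContMDiff ((𝓡 4).prod 𝓘(ℝ, ℝ)) ((𝓡 4).prod 𝓘(ℝ, ℝ)) ∞
        (fun p : M × ℝ ↦ (p.1, p.2 + t₁)) :=
      contMDiff_fst.prodMk (contMDiff_snd.add contMDiff_const)
    refine hu.comp hφ.contMDiffOn ?_
    rintro ⟨x, s⟩ ⟨-, hs⟩
    exact ⟨mem_univ _, hmem s hs⟩
  -- time derivatives of the translates within `[0, τ]`
  have hder : ∀ {u : ℝ → M → ℝ},
      ContMDiffOn ((𝓡 4).prod 𝓘(ℝ, ℝ)) 𝓘(ℝ, ℝ) ∞ (fun p : M × ℝ ↦ u p.2 p.1) (univ ×ˢ Ico 0 T) →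
      ∀ s ∈ Icc 0 τ, ∀ x : M, derivWithin (fun r ↦ u (r + t₁) x) (Icc 0 τ) s =
        derivWithin (fun r ↦ u r x) (Ico 0 T) (s + t₁) := by
    intro u hu s hs x
    have h1 : HasDerivWithinAt (fun r ↦ u r x) (derivWithin (fun r ↦ u r x) (Ico 0 T) (s + t₁))
        (Ico 0 T) (s + t₁) := hasDerivWithinAt_time_of hu x (hmem s hs)
    have h2 : HasDerivWithinAt (fun r : ℝ ↦ r + t₁) 1 (Icc 0 τ) s :=
      (hasDerivWithinAt_id s _).add_const t₁
    have h3 := h1.comp s h2 hmaps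
    rw [mul_one] at h3
    exact h3.derivWithin (uniqueDiffOn_Icc hτ s hs)
  -- the core lemma for the restarted data
  have hcore := bernsteinWindow_core (I := 𝓡 4) (g := fun s ↦ g (s + t₁))
    (f := fun s x ↦ f (s + t₁) x) (F := fun s x ↦ F (s + t₁) x) hτ hθ
    (fun s hs ↦ hgR _ (hmem s hs)) (htr hf) (htr hF)
    (fun s hs x ↦ hfnn _ (hmem s hs) x) (fun s hs x ↦ hFnn _ (hmem s hs) x) hK ha hb hKτ
    (fun x ↦ by simpa using hA₀ x)
    (fun s hs x ↦ by
      beta_reduce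
      rw [hder hf s hs x]
      have h₁ := hevf _ (hmem s hs) x
      have h₂ := hΦf _ (hmem' s hs) x
      linarith)
    (fun s hs x ↦ by
      beta_reduce
      rw [hder hF s hs x]
      have h₁ := hevF _ (hmem s hs) x
      have h₂ := hΦF _ (hmem' s hs) x
      linarith)
  intro t ht x
  have hs : t - t₁ ∈ Icc 0 τ := ⟨by linarith [ht.1], by linarith [ht.2]⟩
  have h := hcore (t - t₁) hs x
  simp only [sub_add_cancel] at h
  exact h

end Summit.SmoothPoincare4.SmoothPoincare4.Theorems.MargerinRails

end
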